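import Summits.AtomisticToContinuum.FouriersLaw.Theorems.PhononMeanFreePathDefs
import Summits.AtomisticToContinuum.FouriersLaw.Theorems.PhononMeanFreePathIncoherentBoundedCoherentLandauer
import Summits.AtomisticToContinuum.FouriersLaw.Theorems.PhononMeanFreePathCoherentDephasingWeakCouplingCorrelationDecay

/-!
# Line `Sketch` of crux `PhononMeanFreePath.CoherentDephasing` (stmt-AtomisticToContinuum-11810): the `N`-uniform dissipation bound for kick responses

Registered sub-goal `kickResp_sq_integral_le` of the line (worker of stub `stub_headBound`; it is the `N`-uniform
input of the head bound, file `…CoherentDephasingHeadBound`). For the `(N+1)`-site pinned anharmonic chain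
`pinnedChain ω₂ lam β γ` (`ω₂, β, γ > 0`, `lam ≥ 0`) with both Langevin baths at `T > 0`, Gibbs measure `μ_T` and
the constructed kernels `K_t`, the kick response of an observable `g` is
`kickResp … N g t = ∫ p₀ · (K_t g) dμ_T` (vocabulary `Theorems/PhononMeanFreePathDefs`, section CoherentField;
`momResp`, `bondForceResp`, … are its instances). For every continuous `g = O(e^{H/(4T)})` and EVERY `N`:

  `t ↦ (kickResp … N g t)² ∈ L¹(0, ∞)` and `∫₀^∞ (kickResp … N g t)² dt ≤ (T/(2γ)) ∫ g² dμ_T`.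

The constant does not depend on `N`: this is the dissipation (Bakry–Émery) inequality of the equilibrium semigroup
(`…IncoherentBoundedDissipation`: `∫₀^∞ ∫ 2Γ(K_s F) dμ_T ds ≤ ∫ F² dμ_T`, `2Γ(u) ≥ 2γT (∂_{p₀} u)²`) combined
with Gaussian integration by parts `∫ p₀ u dμ_T = T ∫ ∂_{p₀} u dμ_T` (`…IncoherentBoundedCoherentLandauer`,
`lintegral_sq_integral_snd_mul_forecast_le`, stated there for `F ∈ C_c`), extended here from `C_c` to
`g = O(e^{H/(4T)})` by truncation `F_k = χ_k g`, dominated convergence (twice) and Fatou in `t` — verbatim the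
route of `lintegral_rN_sq_le` (the case `g = p_N`, `∫₀^∞ r_N² ≤ T²/(2γ)`). The fixed-`N` integrability is the
exponential decorrelation `pinnedChain_corr_exp_decay` with the centred left factor `∫ p₀ dμ_T = 0`.
-/

noncomputable section

open MeasureTheory ProbabilityTheory Filter Topology Set
open scoped NNReal ENNReal

namespace Summit.AtomisticToContinuum.FouriersLaw.Theorems.CoherentDephasing.KickDissipation

open Literature.MathematicalPhysics.KineticTheory.HeatConduction
open Literature.MathematicalPhysics.KineticTheory Literature.Probability.Process OscillatorChain
open Summit.AtomisticToContinuum.FouriersLaw.Theorems.PhononMeanFreePath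
open Summit.AtomisticToContinuum.FouriersLaw.Theorems.SubdiffusiveBondHeat
open Summit.AtomisticToContinuum.FouriersLaw.Theorems.IncoherentBounded

/-! ## The `N`-uniform `L²(dt)` dissipation bound for a general kick response -/

section Dissipation

variable {ω₂ lam β γ : ℝ} (hω : 0 < ω₂) (hl : 0 ≤ lam) (hβ : 0 < β) (hγ : 0 < γ) {T : ℝ} (hT : 0 < T)
include hω hl hβ hγ hT

/-- **The `N`-uniform coherent bound for a general observable, lower-integral form.** For every `N` and every
continuous `g` with `|g| ≤ B e^{H/(4T)}`,

  `∫_{t>0} (kickResp … N g t)² dt ≤ (T/(2γ)) ∫ g² dμ_T`,  `kickResp … g t = ∫ p₀ (K_t g) dμ_T`: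

truncate `g` to `F_k = χ_k g ∈ C_c` (`χ_k` smooth bumps increasing to `1`), apply
`lintegral_sq_integral_snd_mul_forecast_le` (`∫ F_k² dμ_T ≤ ∫ g² dμ_T`), pass to the limit inside the
correlation by dominated convergence (twice) and conclude by Fatou's lemma in `t` (the route of
`lintegral_rN_sq_le`, which is the case `g = p_N`). [folklore] -/
theorem lintegral_kickResp_sq_le (N : ℕ) {g : PhaseSpace (N + 1) → ℝ} (hg : Continuous g) {Bg : ℝ}
    (hgB : ∀ y, |g y| ≤ Bg * Real.exp (1 / (4 * T) * (pinnedChain ω₂ lam β γ).hamiltonian (N + 1) y)) :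
    ∫⁻ t in Ioi (0 : ℝ), ENNReal.ofReal (kickResp ω₂ lam β γ T N g t ^ 2) ≤
      ENNReal.ofReal (T / (2 * γ) * ∫ y, g y ^ 2 ∂((pinnedChain ω₂ lam β γ).gibbsMeasure (N + 1) T)) := by
  set P := pinnedChain ω₂ lam β γ with hP
  set μ := P.gibbsMeasure (N + 1) T with hμ
  haveI : IsProbabilityMeasure μ := pinnedChain_isProbabilityMeasure_gibbsMeasure hω hl hβ.le γ (N + 1) hT
  haveI hMK : ∀ t, IsMarkovKernel (P.transitionKernel (N + 1) T T t) := fun t =>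
    pinnedChain_isMarkovKernel_transitionKernel hω hl hβ.le hγ.le (N + 1) T T t
  have hNp : 0 < N + 1 := Nat.succ_pos N
  -- the truncations `F_k = χ_k · g`
  set χ : ℕ → ContDiffBump (0 : PhaseSpace (N + 1)) := fun k =>
    ⟨(k : ℝ) + 1, (k : ℝ) + 2, by positivity, by linarith⟩ with hχ
  set Fk : ℕ → PhaseSpace (N + 1) → ℝ := fun k y => (χ k) y * g y with hFk
  have hFkc : ∀ k, Continuous (Fk k) := fun k => (χ k).continuous.mul hg
  have hFks : ∀ k, HasCompactSupport (Fk k) := fun k => (χ k).hasCompactSupport.mul_right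
  have hFk_le : ∀ k y, |Fk k y| ≤ |g y| := fun k y => by
    rw [hFk]; dsimp only; rw [abs_mul, abs_of_nonneg (χ k).nonneg]
    exact mul_le_of_le_one_left (abs_nonneg _) (χ k).le_one
  have hFk_lim : ∀ y, Tendsto (fun k => Fk k y) atTop (𝓝 (g y)) := by
    intro y
    refine tendsto_const_nhds.congr' ?_
    obtain ⟨k₀, hk₀⟩ := exists_nat_ge ‖y‖
    filter_upwards [eventually_ge_atTop k₀] with k hk
    rw [hFk]; dsimp only
    rw [(χ k).one_of_mem_closedBall, one_mul]
    rw [Metric.mem_closedBall, dist_zero_right]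
    calc ‖y‖ ≤ k₀ := hk₀
      _ ≤ k := by exact_mod_cast hk
      _ ≤ (k : ℝ) + 1 := by linarith
  -- `L²(μ_T)`-norms of the truncations: `∫ F_k² dμ_T ≤ ∫ g² dμ_T`
  have hϑ0 : (0 : ℝ) < 1 / (4 * T) := by positivity
  have hϑ1 : 1 / (4 * T) < 1 / T := by
    rw [div_lt_div_iff₀ (by positivity) hT]; nlinarith
  have h2ϑ : 2 * (1 / (4 * T)) < 1 / T := by
    rw [show 2 * (1 / (4 * T)) = 1 / (2 * T) by field_simp; ring, div_lt_div_iff₀ (by positivity) hT]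
    nlinarith
  have hg2 : Integrable (fun y => g y ^ 2) μ :=
    (pinnedChain_integral_sq_act_le hω hl hβ hγ hNp hT hϑ0 h2ϑ hg hgB 0).1
  have hFk2 : ∀ k, ∫ y, Fk k y ^ 2 ∂μ ≤ ∫ y, g y ^ 2 ∂μ := by
    intro k
    refine integral_mono_of_nonneg (ae_of_all _ fun y => sq_nonneg _) hg2 (ae_of_all _ fun y => ?_)
    show Fk k y ^ 2 ≤ g y ^ 2
    exact (sq_le_sq' (abs_le.1 (hFk_le k y)).1 (abs_le.1 (hFk_le k y)).2).trans (le_of_eq (sq_abs _))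
  -- the approximating correlations and their limit
  set rk : ℕ → ℝ → ℝ := fun k t => ∫ z, z.2 0 *
    (∫ y, Fk k y ∂(P.transitionKernel (N + 1) T T t.toNNReal z)) ∂μ with hrk
  set r : ℝ → ℝ := fun t => ∫ z, z.2 0 * (∫ y, g y ∂(P.transitionKernel (N + 1) T T t.toNNReal z)) ∂μ with hr
  have hrk_bound : ∀ k, ∫⁻ t in Ioi (0 : ℝ), ENNReal.ofReal (rk k t ^ 2) ≤
      ENNReal.ofReal (T / (2 * γ) * ∫ y, g y ^ 2 ∂μ) := by
    intro k
    refine (lintegral_sq_integral_snd_mul_forecast_le hω hl hβ hγ hNp hT (hFkc k) (hFks k)).trans ?_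
    exact ENNReal.ofReal_le_ofReal (mul_le_mul_of_nonneg_left (hFk2 k) (by positivity))
  have hrk_meas : ∀ k, Measurable (rk k) := fun k =>
    measurable_corr hω hl hβ hγ hT (f := fun z : PhaseSpace (N + 1) => z.2 0) (by fun_prop) (hFkc k)
  -- dominated convergence inside the kernels
  have hin : ∀ (t : ℝ) (z : PhaseSpace (N + 1)),
      Tendsto (fun k => ∫ y, Fk k y ∂(P.transitionKernel (N + 1) T T t.toNNReal z)) atTop
        (𝓝 (∫ y, g y ∂(P.transitionKernel (N + 1) T T t.toNNReal z))) := by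
    intro t z
    have hexpK := pinnedChain_integrable_exp_mul_hamiltonian_transitionKernel hω hl hT hβ.le hγ.le hNp hϑ0 hϑ1
      t.toNNReal z
    have hbd : Integrable (fun y => |g y|) (P.transitionKernel (N + 1) T T t.toNNReal z) :=
      integrable_of_abs_le_exp hexpK (continuous_abs.comp hg) (fun y => by rw [abs_abs]; exact hgB y)
    refine tendsto_integral_of_dominated_convergence (fun y => |g y|)
      (fun k => (hFkc k).aestronglyMeasurable) hbd (fun k => ae_of_all _ fun y => ?_)
      (ae_of_all _ fun y => hFk_lim y)
    rw [Real.norm_eq_abs]; exact hFk_le k y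
  -- dominated convergence under `μ_T`
  have hout : ∀ t : ℝ, Tendsto (fun k => rk k t) atTop (𝓝 (r t)) := by
    intro t
    have hdom : Integrable (fun z : PhaseSpace (N + 1) => |z.2 0| *
        ∫ y, |g y| ∂(P.transitionKernel (N + 1) T T t.toNNReal z)) μ :=
      integrable_mul_act hω hl hβ hγ hT (f := fun z : PhaseSpace (N + 1) => |z.2 0|) (g := fun y => |g y|)
        (by fun_prop) (continuous_abs.comp hg)
        (fun y => by rw [abs_abs]; exact IncoherentBounded.abs_momentum_le_exp hω hl hβ.le hϑ0 y 0)
        (fun y => by rw [abs_abs]; exact hgB y) t.toNNReal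
    refine tendsto_integral_of_dominated_convergence
      (fun z : PhaseSpace (N + 1) => |z.2 0| * ∫ y, |g y| ∂(P.transitionKernel (N + 1) T T t.toNNReal z))
      (fun k => ?_) hdom (fun k => ae_of_all _ fun z => ?_) (ae_of_all _ fun z => (hin t z).const_mul (z.2 0))
    · exact (Continuous.aestronglyMeasurable (by fun_prop)).mul
        ((hFkc k).stronglyMeasurable.integral_kernel
          (κ := P.transitionKernel (N + 1) T T t.toNNReal)).aestronglyMeasurable
    · rw [Real.norm_eq_abs, abs_mul]
      refine mul_le_mul_of_nonneg_left ?_ (abs_nonneg _)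
      have hexpK := pinnedChain_integrable_exp_mul_hamiltonian_transitionKernel hω hl hT hβ.le hγ.le hNp hϑ0 hϑ1
        t.toNNReal z
      have hbd : Integrable (fun y => |g y|) (P.transitionKernel (N + 1) T T t.toNNReal z) :=
        integrable_of_abs_le_exp hexpK (continuous_abs.comp hg) (fun y => by rw [abs_abs]; exact hgB y)
      calc |∫ y, Fk k y ∂(P.transitionKernel (N + 1) T T t.toNNReal z)|
          ≤ ∫ y, |Fk k y| ∂(P.transitionKernel (N + 1) T T t.toNNReal z) := abs_integral_le_integral_abs
        _ ≤ ∫ y, |g y| ∂(P.transitionKernel (N + 1) T T t.toNNReal z) :=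
          integral_mono_of_nonneg (ae_of_all _ fun y => abs_nonneg _) hbd (ae_of_all _ fun y => hFk_le k y)
  -- Fatou in `t`
  have hlim : ∀ t, liminf (fun k => ENNReal.ofReal (rk k t ^ 2)) atTop = ENNReal.ofReal (r t ^ 2) := fun t =>
    (ENNReal.tendsto_ofReal ((hout t).pow 2)).liminf_eq
  show ∫⁻ t in Ioi (0 : ℝ), ENNReal.ofReal (r t ^ 2) ≤ ENNReal.ofReal (T / (2 * γ) * ∫ y, g y ^ 2 ∂μ)
  calc ∫⁻ t in Ioi (0 : ℝ), ENNReal.ofReal (r t ^ 2)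
      = ∫⁻ t in Ioi (0 : ℝ), liminf (fun k => ENNReal.ofReal (rk k t ^ 2)) atTop :=
        lintegral_congr fun t => (hlim t).symm
    _ ≤ liminf (fun k => ∫⁻ t in Ioi (0 : ℝ), ENNReal.ofReal (rk k t ^ 2)) atTop :=
        lintegral_liminf_le fun k => ((hrk_meas k).pow_const 2).ennreal_ofReal
    _ ≤ ENNReal.ofReal (T / (2 * γ) * ∫ y, g y ^ 2 ∂μ) :=
        liminf_le_of_frequently_le' (Frequently.of_forall fun k => hrk_bound k)

/-- **Square-integrability in time of a kick response at fixed `N`**: for continuous `g = O(e^{H/(4T)})`,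
`t ↦ (kickResp … N g t)²` is integrable on `(0, ∞)` (exponential decorrelation at fixed `N`,
`pinnedChain_corr_exp_decay`, with the CENTRED left factor `∫ p₀ dμ_T = 0`). [folklore] -/
theorem kickResp_sq_integrableOn (N : ℕ) {g : PhaseSpace (N + 1) → ℝ} (hg : Continuous g) {Bg : ℝ}
    (hgB : ∀ y, |g y| ≤ Bg * Real.exp (1 / (4 * T) * (pinnedChain ω₂ lam β γ).hamiltonian (N + 1) y)) :
    IntegrableOn (fun t : ℝ => kickResp ω₂ lam β γ T N g t ^ 2) (Ioi 0) := by
  have hϑ0 : (0 : ℝ) < 1 / (4 * T) := by positivity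
  have h2ϑ : 2 * (1 / (4 * T)) < 1 / T := by
    rw [show 2 * (1 / (4 * T)) = 1 / (2 * T) by field_simp; ring, div_lt_div_iff₀ (by positivity) hT]
    nlinarith
  have ha : Continuous fun z : PhaseSpace (N + 1) => z.2 0 := by fun_prop
  obtain ⟨C, c, hc, hb⟩ := pinnedChain_corr_exp_decay hω hl hβ hγ (Nat.succ_pos N) hT hϑ0 h2ϑ ha hg
    (fun y => CoherentDephasing.abs_momentum_le_exp hω.le hl hβ.le hϑ0 y 0) hgB
  have h0 : ∫ z, z.2 0 ∂((pinnedChain ω₂ lam β γ).gibbsMeasure (N + 1) T) = 0 :=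
    pinnedChain_integral_momentum_gibbsMeasure (ω₂ := ω₂) (lam := lam) (β := β) (γ := γ) (N + 1) T 0
  have h2c : 0 < 2 * c := by positivity
  refine Integrable.mono' ((exp_neg_integrableOn_Ioi 0 h2c).const_mul (C ^ 2))
    ((pinnedChain_measurable_corr hω hl hβ hγ hT ha hg).pow_const 2).aestronglyMeasurable ?_
  refine (ae_restrict_iff' measurableSet_Ioi).2 (Eventually.of_forall fun u hu => ?_)
  have h := hb u (le_of_lt hu)
  rw [h0, zero_mul, sub_zero] at h
  rw [Real.norm_eq_abs, abs_pow, sq_abs]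
  calc kickResp ω₂ lam β γ T N g u ^ 2 ≤ (C * Real.exp (-c * u)) ^ 2 := by
        rw [← sq_abs]
        exact pow_le_pow_left₀ (abs_nonneg _) h 2
    _ = C ^ 2 * Real.exp (-(2 * c) * u) := by
        rw [mul_pow, ← Real.exp_nat_mul]; ring_nf

/-- **The `N`-uniform coherent bound for a general observable**: for every `N` and every continuous
`g = O(e^{H/(4T)})`, `∫₀^∞ (kickResp … N g t)² dt ≤ (T/(2γ)) ∫ g² dμ_T`. [folklore] -/
theorem integral_kickResp_sq_le (N : ℕ) {g : PhaseSpace (N + 1) → ℝ} (hg : Continuous g) {Bg : ℝ}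
    (hgB : ∀ y, |g y| ≤ Bg * Real.exp (1 / (4 * T) * (pinnedChain ω₂ lam β γ).hamiltonian (N + 1) y)) :
    ∫ t in Ioi (0 : ℝ), kickResp ω₂ lam β γ T N g t ^ 2 ≤
      T / (2 * γ) * ∫ y, g y ^ 2 ∂((pinnedChain ω₂ lam β γ).gibbsMeasure (N + 1) T) := by
  have hi := kickResp_sq_integrableOn hω hl hβ hγ hT N hg hgB
  have hnn : 0 ≤ T / (2 * γ) * ∫ y, g y ^ 2 ∂((pinnedChain ω₂ lam β γ).gibbsMeasure (N + 1) T) :=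
    mul_nonneg (by positivity) (integral_nonneg fun y => sq_nonneg _)
  rw [integral_eq_lintegral_of_nonneg_ae (ae_of_all _ fun t => sq_nonneg _) hi.aestronglyMeasurable]
  exact ENNReal.toReal_le_of_le_ofReal hnn (lintegral_kickResp_sq_le hω hl hβ hγ hT N hg hgB)

end Dissipation

/-- **kickResp_sq_integral_le** (registered sub-goal; the `N`-uniform input of `stub_headBound`). For
`ω₂, β, γ > 0`, `lam ≥ 0`, `T > 0`, every `N` and every continuous observable `g` of the `(N+1)`-site chain with
`|g| ≤ B_g e^{H/(4T)}`: `t ↦ (kickResp … N g t)²` is integrable on `(0, ∞)` and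
`∫₀^∞ (kickResp … N g t)² dt ≤ (T/(2γ)) ∫ g² dμ_T` — a bound UNIFORM IN `N` (dissipation inequality of the
equilibrium semigroup + Gaussian integration by parts in `p₀`). [folklore] -/
theorem kickResp_sq_integral_le : ∀ ω₂ lam β γ : ℝ, 0 < ω₂ → 0 ≤ lam → 0 < β → 0 < γ → ∀ T : ℝ, 0 < T →
    ∀ (N : ℕ) (g : PhaseSpace (N + 1) → ℝ), Continuous g → ∀ Bg : ℝ,
    (∀ y, |g y| ≤ Bg * Real.exp (1 / (4 * T) * (pinnedChain ω₂ lam β γ).hamiltonian (N + 1) y)) →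
    IntegrableOn (fun t : ℝ => kickResp ω₂ lam β γ T N g t ^ 2) (Ioi 0) ∧
      ∫ t in Ioi (0 : ℝ), kickResp ω₂ lam β γ T N g t ^ 2 ≤
        T / (2 * γ) * ∫ y, g y ^ 2 ∂((pinnedChain ω₂ lam β γ).gibbsMeasure (N + 1) T) :=
  fun _ _ _ _ hω hl hβ hγ _ hT N _ hg _ hgB =>
    ⟨kickResp_sq_integrableOn hω hl hβ hγ hT N hg hgB, integral_kickResp_sq_le hω hl hβ hγ hT N hg hgB⟩

end Summit.AtomisticToContinuum.FouriersLaw.Theorems.CoherentDephasing.KickDissipation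

end
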